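import Summits.Ventures.WeilGRH.TwistedOddParityTailOdd
import Summits.Ventures.WeilGRH.TwistedOddParityDataRung
import HarnessLib

/-!
# GRH arm (rh-explicit, venture WeilGRH): twisted format C with the PARITY-1 kernel in BOTH sectors — the fully
  DATA-ONLY door (door «P»)

Cell `rh-explicit`, WEIL TRACK — GRH ARM (engine seat weil-grh-2 gen8).  weil-grh-5's
`weilPositivityOnChar_of_twistedOdd_formatC_data` (`TwistedOddParityDataRung.lean`) takes the two tail majorants `hU2e`,
`hU2o` as hypotheses; `oddParity_even_tail_majorant_matrix` (weil-grh-5, `TwistedOddParityTailEven.lean`) and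
`oddParity_odd_tail_majorant_matrix` (this seat, `TwistedOddParityTailOdd.lean`) discharge them, so that every remaining
premise is a finite inequality between explicit reals or ONE PSD check per sector:

* `weilPositivityOnChar_of_twistedOdd_formatC_dataP` — `q ≠ 1`, χ REAL and ODD, `a > 0`; EVEN sector: block `Be ≥ 2`, columns
  `2Be ≤ B3e` with weights `0 < we m ≤ d̂⁺_χ(m)`, free `θe, θe' > 0`, sign facts `h0e`, `hd0e`, and the kernel certificate `hSe`
  for `S⁺ = M⁺₁ − Σ_m M⁺₁(·,m)M⁺₁(·,m)ᵀ/we m − U₂⁺`, `U₂⁺ = (1+θe')U₂⁺[parity 0](θe) + (1+θe'⁻¹)·Be(8a/(3π²))²/(3d0e(B3e−1)³)·I`;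
  ODD sector: `Bo ≥ 1`, `2Bo ≤ B3o`, weights `wo`, `θo, θo' > 0`, `h0o`, `hd0o`, `hSo` with
  `U₂⁻ = (1+θo')U₂⁻[parity 0](θo) + (1+θo'⁻¹)·2(8a/(3π²))²/(d0o B3o)·I` ⟹ `WeilPositivityOnChar χ a`.

Why this door (numbers, weil-grh-2 gen8 twin): the hybrid door (parity-1 even sector, parity-0 odd sector) certifies 29 of the 33
odd real cells of the finite remainder below the uniform floors; the four cells `(−3/·) @ 18/25, 3/4, 4023/5000, (log 5)/2` have a
NEGATIVE parity-0 odd-sector block (`−1.2e−3 … −1.1e−2` at `B = 48`) and need the parity bonus in both sectors — this door.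
No definitions; no named facts; RH/GRH-free; standard axioms.
-/

set_option autoImplicit false

noncomputable section

open Complex Finset Matrix
open scoped Real BigOperators ComplexConjugate ArithmeticFunction.vonMangoldt

namespace Summit.Ventures.WeilGRH

open Literature.NumberTheory.LFunctions
open Literature.NumberTheory.LFunctions.Yoshida1992 (freq incrCoeff archCoeff archExpSumSin)
open Literature.Analysis.SpecialFunctions
open Summit.RiemannHypothesis.RiemannHypothesis.Theorems.WeilFormatC

variable {q : ℕ} {a : ℝ}

/-- **Twisted format C with the parity-1 kernel in both sectors — the data-only door «P».**  See the module docstring. -/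
theorem weilPositivityOnChar_of_twistedOdd_formatC_dataP (hq : q ≠ 1) (χ : DirichletCharacter ℂ q)
    (hχ : ∀ n : ℕ, conj (χ (n : ZMod q)) = χ (n : ZMod q)) (hodd : charParity χ = 1) (ha : 0 < a)
    -- EVEN sector data
    {Be B3e : ℕ} (hBe : 2 ≤ Be) (hBBe : 2 * Be ≤ B3e) {θe θe' d0e : ℝ} (hθe : 0 < θe) (hθe' : 0 < θe') (we : ℕ → ℝ)
    (h0e : 0 < ((reDigammaQuarter (freq a Be) - Real.log π + Real.log q) / 2 - a * (1 + weilArchDensity (2 * a)) / (π ^ 2 * Be ^ 2) - 1 / (8 * Be) - a * (1 + weilArchDensity (2 * a)) / π ^ 2 * Real.sqrt (8 / ((Be - 1 : ℕ) : ℝ)) - (∑ k ∈ weilPrimeIndex a, (Λ k : ℝ) / Real.sqrt k * (2 * Real.cos (π / (⌊2 * a / Real.log k⌋₊ + 2)))) / 2))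
    (hd0e : 0 < d0e ∧ d0e ≤ ((reDigammaQuarter (freq a B3e) - Real.log π + Real.log q) / 2 - a * (1 + weilArchDensity (2 * a)) / (π ^ 2 * B3e ^ 2) - 1 / (8 * B3e) - a * (1 + weilArchDensity (2 * a)) / π ^ 2 * Real.sqrt (8 / ((Be - 1 : ℕ) : ℝ)) - (∑ k ∈ weilPrimeIndex a, (Λ k : ℝ) / Real.sqrt k * (2 * Real.cos (π / (⌊2 * a / Real.log k⌋₊ + 2)))) / 2))
    (hwe : ∀ m, Be ≤ m → m < B3e → 0 < we m ∧ we m ≤ ((reDigammaQuarter (freq a m) - Real.log π + Real.log q) / 2 - a * (1 + weilArchDensity (2 * a)) / (π ^ 2 * m ^ 2) - 1 / (8 * m) - a * (1 + weilArchDensity (2 * a)) / π ^ 2 * Real.sqrt (8 / ((Be - 1 : ℕ) : ℝ)) - (∑ k ∈ weilPrimeIndex a, (Λ k : ℝ) / Real.sqrt k * (2 * Real.cos (π / (⌊2 * a / Real.log k⌋₊ + 2)))) / 2))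
    (hSe : ∀ x : Fin Be → ℝ, 0 ≤ ∑ i, ∑ j, x i * x j *
      ((if (i : ℕ) = 0 then twistedGramCoeffOdd χ a 0 j else if (j : ℕ) = 0 then twistedGramCoeffOdd χ a i 0 else (twistedGramCoeffOdd χ a i j + twistedGramCoeffOdd χ a i (-(j : ℤ))) / 2)
        - (∑ m ∈ Finset.Ico Be B3e, (if (i : ℕ) = 0 then twistedGramCoeffOdd χ a 0 m else if m = 0 then twistedGramCoeffOdd χ a i 0 else (twistedGramCoeffOdd χ a i m + twistedGramCoeffOdd χ a i (-(m : ℤ))) / 2) * (if (j : ℕ) = 0 then twistedGramCoeffOdd χ a 0 m else if m = 0 then twistedGramCoeffOdd χ a j 0 else (twistedGramCoeffOdd χ a j m + twistedGramCoeffOdd χ a j (-(m : ℤ))) / 2) / we m)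
        - ((1 + θe') * ((1 + θe) * ((1 + 4 / π * (∑ k ∈ weilPrimeIndex a, (Λ k : ℝ) / Real.sqrt k)) / 4) ^ 2 / (d0e * ((B3e - 1 : ℕ) : ℝ)) * ((-1 : ℝ) ^ (i : ℕ) * (-1 : ℝ) ^ (j : ℕ)) + (if i = j then (1 + θe⁻¹) * (Be / (d0e * ((B3e : ℝ) ^ 2 * ((B3e - 1 : ℕ) : ℝ)))) * (2 * (i : ℕ) * (∑ k ∈ weilPrimeIndex a, (Λ k : ℝ) / Real.sqrt k) / π + (((i : ℕ) : ℝ) / 2 + 8 * a * (1 + weilArchDensity (2 * a)) / (3 * π ^ 2))) ^ 2 else 0)) + (if i = j then (1 + θe'⁻¹) * ((Be : ℝ) * (8 * a / (3 * π ^ 2)) ^ 2 / (3 * d0e * (((B3e - 1 : ℕ) : ℝ)) ^ 3)) else 0))))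
    -- ODD sector data
    {Bo B3o : ℕ} (hBo : 1 ≤ Bo) (hBBo : 2 * Bo ≤ B3o) {θo θo' d0o : ℝ} (hθo : 0 < θo) (hθo' : 0 < θo') (wo : ℕ → ℝ)
    (h0o : 0 < ((reDigammaQuarter (freq a ((Bo : ℤ) + 1)) - Real.log π + Real.log q) / 2 - 1 / (8 * ((Bo : ℝ) + 1)) - a * (1 + weilArchDensity (2 * a)) / (π ^ 2 * ((Bo : ℝ) + 1) ^ 2)) - π / 4 - a * (1 + weilArchDensity (2 * a)) / π ^ 2 * Real.sqrt (8 / Bo) - (∑ k ∈ weilPrimeIndex a, (Λ k : ℝ) / Real.sqrt k * (2 * Real.cos (π / (⌊2 * a / Real.log k⌋₊ + 2)))) / 2)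
    (hd0o : 0 < d0o ∧ d0o ≤ ((reDigammaQuarter (freq a ((B3o : ℤ) + 1)) - Real.log π + Real.log q) / 2 - 1 / (8 * ((B3o : ℝ) + 1)) - a * (1 + weilArchDensity (2 * a)) / (π ^ 2 * ((B3o : ℝ) + 1) ^ 2)) - π / 4 - a * (1 + weilArchDensity (2 * a)) / π ^ 2 * Real.sqrt (8 / Bo) - (∑ k ∈ weilPrimeIndex a, (Λ k : ℝ) / Real.sqrt k * (2 * Real.cos (π / (⌊2 * a / Real.log k⌋₊ + 2)))) / 2)
    (hwo : ∀ l, Bo ≤ l → l < B3o → 0 < wo l ∧ wo l ≤ ((reDigammaQuarter (freq a ((l : ℤ) + 1)) - Real.log π + Real.log q) / 2 - 1 / (8 * ((l : ℝ) + 1)) - a * (1 + weilArchDensity (2 * a)) / (π ^ 2 * ((l : ℝ) + 1) ^ 2) - (π / 2 - Real.arctan (Real.sqrt Bo / Real.sqrt ((l : ℝ) + 1))) / 2 - a * (1 + weilArchDensity (2 * a)) / π ^ 2 * Real.sqrt (8 / Bo) - (∑ k ∈ weilPrimeIndex a, (Λ k : ℝ) / Real.sqrt k * (2 * Real.cos (π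 / (⌊2 * a / Real.log k⌋₊ + 2)))) / 2))
    (hSo : ∀ x : Fin Bo → ℝ, 0 ≤ ∑ k, ∑ k', x k * x k' *
      (((twistedGramCoeffOdd χ a (((k : ℕ) : ℤ) + 1) (((k' : ℕ) : ℤ) + 1) - twistedGramCoeffOdd χ a (((k : ℕ) : ℤ) + 1) (-(((k' : ℕ) : ℤ) + 1))) / 2)
        - (∑ l ∈ Finset.Ico Bo B3o, ((twistedGramCoeffOdd χ a (((k : ℕ) : ℤ) + 1) ((l : ℤ) + 1) - twistedGramCoeffOdd χ a (((k : ℕ) : ℤ) + 1) (-((l : ℤ) + 1))) / 2) * ((twistedGramCoeffOdd χ a (((k' : ℕ) : ℤ) + 1) ((l : ℤ) + 1) - twistedGramCoeffOdd χ a (((k' : ℕ) : ℤ) + 1) (-((l : ℤ) + 1))) / 2) / wo l)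
        - ((1 + θo') * ((1 + θo) * (1 / (d0o * B3o)) * (((-1 : ℝ) ^ ((k : ℕ) + 1) * (-(∑ j ∈ weilPrimeIndex a, (χ (j : ZMod q)).re * ((Λ j : ℝ) / Real.sqrt j) * Real.sin (freq a (((k : ℕ) : ℤ) + 1) * Real.log j)) / π - (Complex.digamma (1 / 4 + ((freq a (((k : ℕ) : ℤ) + 1) : ℝ) : ℂ) / 2 * I)).im / (2 * π) + archExpSumSin a (((k : ℕ) : ℤ) + 1) / π)) * ((-1 : ℝ) ^ ((k' : ℕ) + 1) * (-(∑ j ∈ weilPrimeIndex a, (χ (j : ZMod q)).re * ((Λ j : ℝ) / Real.sqrt j) * Real.sin (freq a (((k' : ℕ) : ℤ) + 1) * Real.log j)) / π - (Complex.digamma (1 / 4 + ((freq a (((k' : ℕ) : ℤ) + 1) : ℝ) : ℂ) / 2 * I)).im / (2 * π) + archExpSumSin a (((k' : ℕ) : ℤ) + 1) / π))) + (if k = k' then (1 + θo⁻¹) * (Bo / (d0o * ((((B3o : ℝ) + 1) ^ 2) * (B3o : ℝ)))) * (2 * ((k : ℕ) + 1 : ℕ) * (∑ k ∈ weilPrimeIndex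 a, (Λ k : ℝ) / Real.sqrt k) / π + ((((k : ℕ) + 1 : ℕ) : ℝ) / 2 + 4 * a * (1 + weilArchDensity (2 * a)) / (3 * π ^ 2))) ^ 2 else 0)) + (if k = k' then (1 + θo'⁻¹) * (2 * (8 * a / (3 * π ^ 2)) ^ 2 / (d0o * (B3o : ℝ))) else 0)))) :
    WeilPositivityOnChar χ a := by
  have hE0 : 0 < weilArchDensity (2 * a) := weilArchDensity_pos (by positivity)
  have hC : 0 ≤ a * (1 + weilArchDensity (2 * a)) := by positivity
  set dev : ℕ → ℝ := fun m ↦ ((reDigammaQuarter (freq a m) - Real.log π + Real.log q) / 2 - a * (1 + weilArchDensity (2 * a)) / (π ^ 2 * m ^ 2) - 1 / (8 * m) - a * (1 + weilArchDensity (2 * a)) / π ^ 2 * Real.sqrt (8 / ((Be - 1 : ℕ) : ℝ)) - (∑ k ∈ weilPrimeIndex a, (Λ k : ℝ) / Real.sqrt k * (2 * Real.cos (π / (⌊2 * a / Real.log k⌋₊ + 2)))) / 2) with hdev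
  set dod : ℕ → ℝ := fun l ↦ ((reDigammaQuarter (freq a ((l : ℤ) + 1)) - Real.log π + Real.log q) / 2 - 1 / (8 * ((l : ℝ) + 1)) - a * (1 + weilArchDensity (2 * a)) / (π ^ 2 * ((l : ℝ) + 1) ^ 2) - (π / 2 - Real.arctan (Real.sqrt Bo / Real.sqrt ((l : ℝ) + 1))) / 2 - a * (1 + weilArchDensity (2 * a)) / π ^ 2 * Real.sqrt (8 / Bo) - (∑ k ∈ weilPrimeIndex a, (Λ k : ℝ) / Real.sqrt k * (2 * Real.cos (π / (⌊2 * a / Real.log k⌋₊ + 2)))) / 2) with hdod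
  have hB3e : 2 ≤ B3e := by omega
  have hB3e1 : 1 ≤ B3e := by omega
  have hB3o : 1 ≤ B3o := by omega
  have hdmono : ∀ m, B3e ≤ m → d0e ≤ dev m := fun m hm ↦ by
    simp only [hdev]
    have h := even_dhat_core_mono ha hC hB3e1 hm
    linarith [hd0e.2]
  have hdlow : ∀ l, B3o ≤ l → d0o ≤ dod l := fun l hl ↦ by
    simp only [hdod]
    have h := odd_dhat_core_mono ha hC hl
    have hpen := hilbert_atan_penalty_le Bo l
    linarith [hd0o.2]
  have hU2e := fun (N : ℕ) (x : Fin Be → ℝ) ↦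
    oddParity_even_tail_majorant_matrix χ ha hBBe hB3e dev hd0e.1 hdmono hθe hθe' N x
  have hU2o := fun (N : ℕ) (x : Fin Bo → ℝ) ↦
    oddParity_odd_tail_majorant_matrix χ ha hBBo hB3o dod hd0o.1 hdlow hθo hθo' N x
  refine weilPositivityOnChar_of_twistedOdd_formatC_data hq χ hχ hodd ha hBe (by omega) we _ h0e hwe
    (fun N x ↦ by
      have h := hU2e N x
      simp only [hdev] at h
      exact h)
    (fun x ↦ by
      have h := hSe x
      simp only [Matrix.of_apply]
      exact h)
    hBo (by omega) wo _ h0o hwo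
    (fun N x ↦ by
      have h := hU2o N x
      simp only [hdod] at h
      exact h)
    (fun x ↦ by
      have h := hSo x
      simp only [Matrix.of_apply]
      exact h)

end Summit.Ventures.WeilGRH

end
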